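import Summits.RiemannHypothesis.RiemannHypothesis.Theorems.UniversalFactorLehmerCell

/-!
# RiemannHypothesis / UniversalFactor — the sign of `H_0(2t₀)` from the sign of `Re lehmerCore`

Route `RiemannHypothesis/UniversalFactor`, item `MediumKernelNoGo` (stmt-RiemannHypothesis-2577),
line `one-sided-average-sign-test`, stub `stub_highH0neg`.

The dip certificate at `x₀ = 2t₀` needs `H_0(x₀) < 0`.  By
`UniversalFactor.deBruijnH_zero_two_mul_repr` there is a real `μ` with
`Re H_0(2t₀) · μ = −K₀ · Re (lehmerCore t₀ (½ + it₀))`, and for `t₀ ≥ 7000` the factor `μ` is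
positive (`UniversalFactor.lehmer_mu_bounds`), as is `K₀ = lehmerK0 t₀`
(`UniversalFactor.lehmerK0_pos`).  Hence `Re lehmerCore t₀ (½ + it₀) > 0` forces `Re H_0(2t₀) < 0`.

* `UniversalFactor.stub_highH0neg` — the sign transfer.
-/

noncomputable section

set_option linter.dupNamespace false

namespace Summit.RiemannHypothesis.RiemannHypothesis.Theorems

open Complex Real
open Literature.NumberTheory.LFunctions

/-- **Sign transfer** (stub `stub_highH0neg`): for `t₀ ≥ 7000`, if the real part of the Lehmer core
`lehmerCore t₀ (½ + it₀)` is positive then `Re H_0(2t₀) < 0`.  This follows from the representation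
`Re H_0(2t) · μ = −K₀ · Re lehmerCore t₀ (½ + it)` with `μ > 0` and `K₀ > 0`. [folklore] -/
theorem UniversalFactor.stub_highH0neg :
    ∀ t₀ : ℝ, 7000 ≤ t₀ → 0 < (UniversalFactor.lehmerCore t₀ (1 / 2 + (t₀ : ℂ) * Complex.I)).re →
      (deBruijnH 0 ((2 * t₀ : ℝ) : ℂ)).re < 0 := by
  intro t₀ ht₀ hcore
  have ht : |t₀ - t₀| ≤ 1 := by simp
  obtain ⟨hsmall, hμ⟩ := UniversalFactor.lehmer_mu_bounds ht₀ ht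
  obtain ⟨μ, hμ1, hμ2, hid⟩ := UniversalFactor.deBruijnH_zero_two_mul_repr (t₀ := t₀) (t := t₀)
    (by linarith) (by linarith) hsmall
  obtain ⟨hμpos, -⟩ := hμ μ hμ1 hμ2
  have hK := UniversalFactor.lehmerK0_pos t₀
  -- the right-hand side of the representation is negative
  have hneg : (deBruijnH 0 ((2 * t₀ : ℝ) : ℂ)).re * μ < 0 := by
    rw [hid, neg_mul]
    exact neg_neg_of_pos (mul_pos hK hcore)
  -- a product with a positive factor is negative only if the other factor is negative
  by_contra h
  exact absurd hneg (not_lt.2 (mul_nonneg (not_lt.1 h) hμpos.le))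

end Summit.RiemannHypothesis.RiemannHypothesis.Theorems
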